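import Literature.IUT.HodgeArakelov.IotaInvariantThetaR

/-!
# [IUTchII] Prop 2.2 (ii), the «respectively» clause: `∞θ^ι(Π_v)` is ONE `μ`-orbit within each
# `{(l·ℤ) × μ}`-orbit of `∞θ(Π_v)` — typed and proved over `IotaInvariantTheta'`

S. Mochizuki, *Inter-universal Teichmüller theory II*, kurims manuscript (Dec. 2020) §2, Proposition 2.2 (ii),
p. 66 l. 51–61 (claim key `Mochizuki2012`, DISPUTED, D-0012; abc-iut cell, D-0068 (1) sub-DAG row
Prop-22.ii.r13a of plan/L6/SUBDAG-IUTchII-Prop-22.md, holder abc-iut-w5-d187). Printed sentence: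

  «… determines a specific `μ_{2l}`- (respectively, `μ (= M^μ_TM(Π_v))`-) orbit `θ^ι(Π_v) ⊆ θ(Π_v)` (respectively,
  `∞θ^ι(Π_v) ⊆ ∞θ(Π_v)`) within the unique `{(l·ℤ) × μ_{2l}}`- (respectively, each `{(l·ℤ) × μ}`-) orbit contained in
  the set `θ(Π_v)` (respectively, `∞θ(Π_v)`) [cf. Proposition 1.4; Corollary 1.12, (ii)].»

The typed statement of record `IotaInvariantTheta'` (`IotaInvariantThetaR.lean`, p408487) carries the `H¹`-level
clause (`thetaIota_nonempty`, `thetaIota_orbit`: `θ^ι(Π_v)` is nonempty and any two members differ by a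
`2l`-torsion class) and DEFINES the limit-level set `∞θ^ι(Π_v)` (`IotaInvariantTheta'.thetaInftyIota`: the members
of `∞θ(Π_v)` that are `ι`-invariant up to torsion), but types NO property of it. This file types the
«respectively» clause and PROVES it from the `H¹`-level clause:

* `EtaleThetaData.IsRootOfLevel D N x` — `x ∈ lim_J H¹` is an `N`-th root, up to torsion, of (the image of) a class of
  `θ(Π_v)`; `∞θ(Π_v)` is by definition the union of the positive levels (`mem_thetaInfty_iff_exists_level`).
  `EtaleThetaData.SameRootLevel D x x'` — a common positive root level. This is the interface-level rendering of
  «`x`, `x'` lie in the same `{(l·ℤ) × μ}`-orbit of `∞θ(Π_v)`»: `θ(Π_v)` is ONE `{(l·ℤ) × μ_{2l}}`-orbit (Prop. 1.4: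
  the `(l·ℤ × μ_2)`-translates of the class of an `l`-th root of the étale theta function), `l·ℤ` acts through
  additive automorphisms of the limit commuting with `N • (−)` and `μ` = the torsion of the limit, so members of one
  `{(l·ℤ) × μ}`-orbit have a common root level. (Over the axiom-free interface the level of an element need not
  be unique; the printed orbit relation IMPLIES `SameRootLevel`, which is all the uniqueness statement consumes.)
* `IotaInvariantTheta'.InftyClause Θ` — the typed «respectively» clause: `∞θ^ι(Π_v)` is nonempty; any two of
  its members of a common root level differ by a torsion class (a `μ`-orbit); every inhabited level of `∞θ(Π_v)`
  meets `∞θ^ι(Π_v)` («within EACH orbit»).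
* PROVED: `thetaInftyIota_nonempty` and `toLim_mem_thetaInftyIota` (the image of `θ^ι` lies in `∞θ^ι`) outright;
  `isOfFinAddOrder_sub_of_sameRootLevel` (the `μ`-orbit statement) from ONE interface-level input, taken as an
  explicit binder: `hker : Ker(H¹(Π_Ÿ(Π_v), (l·Δ_Θ)(Π_v)) → lim_J) ⊆ torsion` — at the model this is
  inflation–restriction (the kernel of restriction to a finite-index open `J` is killed by the index;
  cf. `Literature.AnabelianGeometry.EtaleTheta.ContH1.res_injective_of_forall_fixed_eq_one`, p412530, and
  ContH1InfRes p411157); `exists_mem_thetaInftyIota_of_level` (existence within each orbit) from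
  `hdiv : every class of θ(Π_v) has N-th roots in the limit for every N > 0` — at the model the divisibility of
  Kummer classes in `lim_J H¹(Π_Ÿ|_J, l·Δ_Θ)` ([EtTh] §1: roots of `Θ̈` exist on finite étale coverings);
  assembly `inftyClause_of_ker_torsion`. Route: an `N`-th root `x` of `t ∈ θ(Π_v)` is `ι`-invariant up to torsion
  iff `t` is (push `ι(x) − x` through `N • (−)`, `iota_compat`, and `hker`), and two `ι`-invariant `t, t'` differ
  by `2l`-torsion (`thetaIota_orbit`), so `N • (x − x')` is torsion, hence `x − x'` is.

No new Prop FACT: `IsRootOfLevel` / `SameRootLevel` / `InftyClause` are typed STATEMENTS of the printed clause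
(statements-first, D-0068 (1)); the two inputs are theorem binders. Nothing here takes a side on [IUTchIII]
Cor. 3.12; typed ≠ proved for the inputs.
-/

namespace Literature.IUT.HodgeArakelov

universe u

/-! ## Root levels in `∞θ(Π)` (over the Prop. 1.4 output `EtaleThetaData`) -/

namespace EtaleThetaData

variable {S' : ThetaSetting.{u}} {P : TopGroup.{u}} (D : EtaleThetaData S' P)

/-- **IUTchII:Prop2.2(ii)** (kurims p.66 l.59–61; with Prop 1.4 p.27 «some [positive integer] multiple
coincides, up to torsion, with an element of `θ(Π)`»): `x ∈ lim_J H¹(Π_Ÿ(Π)|_J, (l·Δ_Θ)(Π))` is an `N`-th ROOT, up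
to torsion, of (the image in the limit of) a class of `θ(Π)` (DEFINED).
[claim: Mochizuki2012, status: disputed] (IUTchII §2 Prop 2.2 (ii), kurims p.66) -/
def IsRootOfLevel (N : ℕ) (x : D.coh.lim) : Prop :=
  ∃ t ∈ D.theta, IsOfFinAddOrder (N • x - D.coh.toLim ⊤ t)

/-- **IUTchII:Prop2.2(ii)** (kurims p.66 l.59–61) «each `{(l·ℤ) × μ}`-orbit contained in the set `∞θ(Π_v)`»,
interface-level rendering: `x`, `x'` have a COMMON positive root level over `θ(Π_v)` (DEFINED). Since `θ(Π_v)` is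
one `{(l·ℤ) × μ_{2l}}`-orbit (Prop 1.4), members of one `{(l·ℤ) × μ}`-orbit of `∞θ(Π_v)` satisfy this.
[claim: Mochizuki2012, status: disputed] (IUTchII §2 Prop 2.2 (ii), kurims p.66) -/
def SameRootLevel (x x' : D.coh.lim) : Prop :=
  ∃ N : ℕ, 0 < N ∧ D.IsRootOfLevel N x ∧ D.IsRootOfLevel N x'

/-- PROVED (definitional): `∞θ(Π)` is the union of the positive root levels over `θ(Π)` — the DEFINITION
`EtaleThetaData.thetaInfty` of Prop 1.4 read through `IsRootOfLevel`.
[claim: Mochizuki2012, status: disputed] (IUTchII §1 Prop 1.4, kurims p.27) -/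
theorem mem_thetaInfty_iff_exists_level (x : D.coh.lim) :
    x ∈ D.thetaInfty ↔ ∃ N : ℕ, 0 < N ∧ D.IsRootOfLevel N x :=
  Iff.rfl

/-- PROVED: the image in the limit of a class of `θ(Π)` has root level `1`.
[claim: Mochizuki2012, status: disputed] (IUTchII §1 Prop 1.4, kurims p.27) -/
theorem isRootOfLevel_one_toLim {t : D.coh.H1 ⊤} (ht : t ∈ D.theta) :
    D.IsRootOfLevel 1 (D.coh.toLim ⊤ t) :=
  ⟨t, ht, by rw [one_smul, sub_self]; exact IsOfFinAddOrder.zero⟩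

/-- PROVED: `SameRootLevel` is symmetric. [claim: Mochizuki2012, status: disputed]
(IUTchII §2 Prop 2.2 (ii), kurims p.66) -/
theorem SameRootLevel.symm {x x' : D.coh.lim} (h : D.SameRootLevel x x') : D.SameRootLevel x' x := by
  obtain ⟨N, hN, hx, hx'⟩ := h
  exact ⟨N, hN, hx', hx⟩

/-- PROVED: every member of `∞θ(Π)` has the root level of itself (reflexivity on `∞θ(Π)`).
[claim: Mochizuki2012, status: disputed] (IUTchII §2 Prop 2.2 (ii), kurims p.66) -/
theorem sameRootLevel_self_of_mem_thetaInfty {x : D.coh.lim} (hx : x ∈ D.thetaInfty) :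
    D.SameRootLevel x x := by
  obtain ⟨N, hN, h⟩ := (D.mem_thetaInfty_iff_exists_level x).mp hx
  exact ⟨N, hN, h, h⟩

/-- If the kernel of `H¹(Π_Ÿ(Π), (l·Δ_Θ)(Π)) → lim_J` consists of torsion classes (inflation–restriction), then a class
whose image in the limit is torsion is itself torsion (PROVED; the step of the printed argument that descends
`ι`-invariance from the limit to `H¹`). [claim: Mochizuki2012, status: disputed] (IUTchII §2 Prop 2.2 (ii), kurims p.66) -/
theorem isOfFinAddOrder_of_toLim (hker : ∀ y : D.coh.H1 ⊤, D.coh.toLim ⊤ y = 0 → IsOfFinAddOrder y)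
    {y : D.coh.H1 ⊤} (h : IsOfFinAddOrder (D.coh.toLim ⊤ y)) : IsOfFinAddOrder y := by
  obtain ⟨n, hn, hny⟩ := h.exists_nsmul_eq_zero
  have h1 : D.coh.toLim ⊤ (n • y) = 0 := by rw [map_nsmul, hny]
  exact (hker _ h1).of_nsmul hn.ne'

end EtaleThetaData

/-! ## The «respectively» clause of Prop. 2.2 (ii) over `IotaInvariantTheta'` -/

namespace IotaInvariantTheta'

variable {S : BadPlaceSetting.{u}} {P : TopGroup.{u}} {T : TemperedCoverings S P}
  {D : EtaleThetaData S.toThetaSetting P} {Dec : SubgraphDecomposition S T D} (Θ : IotaInvariantTheta' Dec)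

/-- **IUTchII:Prop2.2(ii)** (kurims p.66 l.56–61), the «respectively» clause TYPED: the functorial algorithms of
Prop 1.4 «together with the condition of invariance with respect to `ι` … determine a specific `μ (= M^μ_TM(Π_v))`-orbit
`∞θ^ι(Π_v) ⊆ ∞θ(Π_v)` within each `{(l·ℤ) × μ}`-orbit contained in the set `∞θ(Π_v)`»: (1) `∞θ^ι(Π_v) ≠ ∅`; (2) ONE
`μ`-orbit per `{(l·ℤ) × μ}`-orbit — any two members of `∞θ^ι(Π_v)` with a common root level differ by a torsion class
(`μ` = the torsion of the limit module, written additively as in Cor 1.12); (3) «within EACH orbit» — every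
inhabited root level of `∞θ(Π_v)` meets `∞θ^ι(Π_v)`. [claim: Mochizuki2012, status: disputed]
(IUTchII §2 Prop 2.2 (ii), kurims p.66) -/
def InftyClause : Prop :=
  Θ.thetaInftyIota.Nonempty ∧
    (∀ x ∈ Θ.thetaInftyIota, ∀ x' ∈ Θ.thetaInftyIota, D.SameRootLevel x x' → IsOfFinAddOrder (x - x')) ∧
    ∀ N : ℕ, 0 < N → (∃ x, D.IsRootOfLevel N x) → ∃ x' ∈ Θ.thetaInftyIota, D.IsRootOfLevel N x'

/-- PROVED: membership in `∞θ^ι(Π_v)` unfolded. [claim: Mochizuki2012, status: disputed]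
(IUTchII §2 Prop 2.2 (ii), kurims p.66) -/
theorem mem_thetaInftyIota_iff (x : D.coh.lim) :
    x ∈ Θ.thetaInftyIota ↔ x ∈ D.thetaInfty ∧ IsOfFinAddOrder (Θ.iotaLim x - x) :=
  Iff.rfl

/-- PROVED: «`θ^ι(Π_v) ⊆ θ(Π_v)` (respectively, `∞θ^ι(Π_v) ⊆ ∞θ(Π_v)`)» are compatible — the image in the limit of an
element of `θ^ι(Π_v)` lies in `∞θ^ι(Π_v)` (by `iota_compat`). [claim: Mochizuki2012, status: disputed]
(IUTchII §2 Prop 2.2 (ii), kurims p.66) -/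
theorem toLim_mem_thetaInftyIota {t : D.coh.H1 ⊤} (ht : t ∈ Θ.thetaIota) :
    D.coh.toLim ⊤ t ∈ Θ.thetaInftyIota := by
  obtain ⟨htθ, hfin⟩ := ht
  refine ⟨⟨1, Nat.one_pos, t, htθ, ?_⟩, ?_⟩
  · rw [one_smul, sub_self]
    exact IsOfFinAddOrder.zero
  · rw [← Θ.iota_compat, ← map_sub]
    exact (D.coh.toLim ⊤).isOfFinAddOrder hfin

/-- **IUTchII:Prop2.2(ii)** «respectively» clause (1), PROVED outright: `∞θ^ι(Π_v)` is nonempty (it contains the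
image of `θ^ι(Π_v)`, which is nonempty by the `H¹`-level clause). [claim: Mochizuki2012, status: disputed]
(IUTchII §2 Prop 2.2 (ii), kurims p.66) -/
theorem thetaInftyIota_nonempty : Θ.thetaInftyIota.Nonempty := by
  obtain ⟨t, ht⟩ := Θ.thetaIota_nonempty'
  exact ⟨_, Θ.toLim_mem_thetaInftyIota ht⟩

/-- KEY STEP (the proof of [EtTh] Thm 1.6 (iii) read in the limit): if `x ∈ ∞θ^ι(Π_v)` is an `N`-th root (`N > 0`),
up to torsion, of `t ∈ θ(Π_v)`, then `t` is `ι`-invariant up to torsion — given that `Ker(H¹ → lim)` is torsion.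
Indeed `ι(t) − t` maps to `ι(N•x) − N•x` up to torsion in the limit. [claim: Mochizuki2012, status: disputed]
(IUTchII §2 Prop 2.2 (ii), kurims p.66) -/
theorem isOfFinAddOrder_iotaH1_sub_of_root
    (hker : ∀ y : D.coh.H1 ⊤, D.coh.toLim ⊤ y = 0 → IsOfFinAddOrder y)
    {x : D.coh.lim} (hx : x ∈ Θ.thetaInftyIota) {N : ℕ} {t : D.coh.H1 ⊤}
    (hroot : IsOfFinAddOrder (N • x - D.coh.toLim ⊤ t)) :
    IsOfFinAddOrder (Θ.iotaH1 t - t) := by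
  have hinv : IsOfFinAddOrder (Θ.iotaLim x - x) := hx.2
  -- push the root relation through `ι`
  have h1 : IsOfFinAddOrder (N • Θ.iotaLim x - Θ.iotaLim (D.coh.toLim ⊤ t)) := by
    have := Θ.iotaLim.toAddMonoidHom.isOfFinAddOrder hroot
    simpa [map_sub, map_nsmul] using this
  have h2 : IsOfFinAddOrder (N • Θ.iotaLim x - N • x) := by
    rw [← smul_sub]
    exact hinv.nsmul
  -- `ι(L t) − L t = (ι(L t) − N•ι x) + (N•ι x − N•x) + (N•x − L t)`
  have h3 : IsOfFinAddOrder (Θ.iotaLim (D.coh.toLim ⊤ t) - D.coh.toLim ⊤ t) := by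
    have hsum := (h1.neg.add h2).add hroot
    have heq : -(N • Θ.iotaLim x - Θ.iotaLim (D.coh.toLim ⊤ t)) + (N • Θ.iotaLim x - N • x) +
        (N • x - D.coh.toLim ⊤ t) = Θ.iotaLim (D.coh.toLim ⊤ t) - D.coh.toLim ⊤ t := by abel
    rwa [heq] at hsum
  -- `ι(L t) = L(ι t)` by `iota_compat`
  rw [← Θ.iota_compat, ← map_sub] at h3
  exact D.isOfFinAddOrder_of_toLim hker h3

/-- **IUTchII:Prop2.2(ii)** «respectively» clause (2), PROVED modulo `hker` (inflation–restriction): any two members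
of `∞θ^ι(Π_v)` with a common root level differ by a TORSION class — `∞θ^ι(Π_v)` meets each `{(l·ℤ) × μ}`-orbit of
`∞θ(Π_v)` in at most one `μ`-orbit. [claim: Mochizuki2012, status: disputed] (IUTchII §2 Prop 2.2 (ii), kurims p.66) -/
theorem isOfFinAddOrder_sub_of_sameRootLevel
    (hker : ∀ y : D.coh.H1 ⊤, D.coh.toLim ⊤ y = 0 → IsOfFinAddOrder y)
    {x x' : D.coh.lim} (hx : x ∈ Θ.thetaInftyIota) (hx' : x' ∈ Θ.thetaInftyIota)
    (h : D.SameRootLevel x x') : IsOfFinAddOrder (x - x') := by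
  obtain ⟨N, hN, ⟨t, ht, hroot⟩, ⟨t', ht', hroot'⟩⟩ := h
  have hinv : IsOfFinAddOrder (Θ.iotaH1 t - t) := Θ.isOfFinAddOrder_iotaH1_sub_of_root hker hx hroot
  have hinv' : IsOfFinAddOrder (Θ.iotaH1 t' - t') := Θ.isOfFinAddOrder_iotaH1_sub_of_root hker hx' hroot'
  -- the `H¹`-level clause: `t' − t` is `2l`-torsion
  have htt : IsOfFinAddOrder (t - t') := by
    have h0 : (2 * S.l) • (t' - t) = 0 := Θ.thetaIota_orbit t ht t' ht' hinv hinv'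
    have hfin : IsOfFinAddOrder (t' - t) :=
      isOfFinAddOrder_iff_nsmul_eq_zero.mpr ⟨2 * S.l, by have := S.l_prime.pos; omega, h0⟩
    have := hfin.neg
    rwa [neg_sub] at this
  have hL : IsOfFinAddOrder (D.coh.toLim ⊤ t - D.coh.toLim ⊤ t') := by
    rw [← map_sub]
    exact (D.coh.toLim ⊤).isOfFinAddOrder htt
  -- `N • (x − x') = (N•x − L t) − (N•x' − L t') + (L t − L t')`
  have hN' : IsOfFinAddOrder (N • (x - x')) := by
    have hsum := (hroot.add hroot'.neg).add hL
    have heq : N • x - D.coh.toLim ⊤ t + -(N • x' - D.coh.toLim ⊤ t') +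
        (D.coh.toLim ⊤ t - D.coh.toLim ⊤ t') = N • (x - x') := by
      rw [smul_sub]; abel
    rwa [heq] at hsum
  exact hN'.of_nsmul hN.ne'

/-- **IUTchII:Prop2.2(ii)** «respectively» clause (3) «within EACH `{(l·ℤ) × μ}`-orbit», PROVED modulo `hdiv`
(divisibility of the Kummer classes of `θ(Π_v)` in the limit): every positive root level contains a member of
`∞θ^ι(Π_v)` — an `N`-th root of an `ι`-invariant class is `ι`-invariant up to torsion.
[claim: Mochizuki2012, status: disputed] (IUTchII §2 Prop 2.2 (ii), kurims p.66) -/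
theorem exists_mem_thetaInftyIota_of_level
    (hdiv : ∀ t ∈ D.theta, ∀ N : ℕ, 0 < N → ∃ x : D.coh.lim, N • x = D.coh.toLim ⊤ t)
    {N : ℕ} (hN : 0 < N) : ∃ x' ∈ Θ.thetaInftyIota, D.IsRootOfLevel N x' := by
  obtain ⟨t₀, ht₀, hinv₀⟩ := Θ.thetaIota_nonempty
  obtain ⟨x, hx⟩ := hdiv t₀ ht₀ N hN
  have hroot : IsOfFinAddOrder (N • x - D.coh.toLim ⊤ t₀) := by
    rw [hx, sub_self]; exact IsOfFinAddOrder.zero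
  refine ⟨x, ⟨⟨N, hN, t₀, ht₀, hroot⟩, ?_⟩, t₀, ht₀, hroot⟩
  -- `N • (ι x − x) = ι(L t₀) − L t₀ = L(ι t₀ − t₀)` is torsion
  have h1 : N • (Θ.iotaLim x - x) = D.coh.toLim ⊤ (Θ.iotaH1 t₀ - t₀) := by
    rw [smul_sub, ← map_nsmul, hx, map_sub, Θ.iota_compat]
  have h2 : IsOfFinAddOrder (N • (Θ.iotaLim x - x)) := by
    rw [h1]
    exact (D.coh.toLim ⊤).isOfFinAddOrder hinv₀
  exact h2.of_nsmul hN.ne'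

/-- **IUTchII:Prop2.2(ii)** «respectively» clause ASSEMBLED: `InftyClause` holds for every `IotaInvariantTheta'` datum,
given (hker) `Ker(H¹(Π_Ÿ(Π_v), (l·Δ_Θ)(Π_v)) → lim_J)` is torsion (inflation–restriction) and (hdiv) the classes of
`θ(Π_v)` are divisible in the limit. [claim: Mochizuki2012, status: disputed] (IUTchII §2 Prop 2.2 (ii), kurims p.66) -/
theorem inftyClause_of_ker_torsion
    (hker : ∀ y : D.coh.H1 ⊤, D.coh.toLim ⊤ y = 0 → IsOfFinAddOrder y)
    (hdiv : ∀ t ∈ D.theta, ∀ N : ℕ, 0 < N → ∃ x : D.coh.lim, N • x = D.coh.toLim ⊤ t) :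
    Θ.InftyClause :=
  ⟨Θ.thetaInftyIota_nonempty,
    fun _ hx _ hx' h => Θ.isOfFinAddOrder_sub_of_sameRootLevel hker hx hx' h,
    fun _ hN _ => Θ.exists_mem_thetaInftyIota_of_level hdiv hN⟩

/-- Without `hdiv`, clauses (1) and (2) alone: `∞θ^ι(Π_v)` is nonempty and meets every `{(l·ℤ) × μ}`-orbit in at
most one `μ`-orbit. [claim: Mochizuki2012, status: disputed] (IUTchII §2 Prop 2.2 (ii), kurims p.66) -/
theorem inftyClause_uniqueness_of_ker_torsion
    (hker : ∀ y : D.coh.H1 ⊤, D.coh.toLim ⊤ y = 0 → IsOfFinAddOrder y) :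
    Θ.thetaInftyIota.Nonempty ∧
      ∀ x ∈ Θ.thetaInftyIota, ∀ x' ∈ Θ.thetaInftyIota, D.SameRootLevel x x' → IsOfFinAddOrder (x - x') :=
  ⟨Θ.thetaInftyIota_nonempty, fun _ hx _ hx' h => Θ.isOfFinAddOrder_sub_of_sameRootLevel hker hx hx' h⟩

end IotaInvariantTheta'

end Literature.IUT.HodgeArakelov
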